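import Summits.ResolutionOfSingularities.ResolutionOfSingularities.Theorems.EquisingularLiftEquisingularLiftLinkedNode
import Mathlib.RingTheory.Filtration
import Mathlib.Data.Fintype.EquivFin
import HarnessLib

/-!
# Crux `EquisingularLift` (stmt-ResolutionOfSingularities-15660), line `Sketch` (= `strata-split` v6):
# move-set stub `stub_exists_arc_transversal` (free arcs through any point)

[OURS · L1 W4.5b] Registered stub of the skeleton `Cruxes/EquisingularLift/Lines/Sketch.lean`
(sha `ec60f88acc0b`), proved BY NAME AND SIGNATURE; idea card `free-arcs-jet-surgery`, lemma 1.
NOT a statement of any manuscript.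

**Statement.** Let `(R, 𝔪)` be a regular local ring with infinite residue field, `ϖ ≠ 0`, and
`I ⊆ 𝔪` an ideal with `I ⊄ 𝔪²`. Then there is an ideal `𝔮` with `R/𝔮` regular local of dimension `1`
(a DVR: the arc), `ϖ ∉ 𝔮` (the arc is horizontal) and `𝔮 + I = 𝔪` (the arc is transversal to `V(I)`).

**Proof** (induction on `d = dim R ≥ 1`; `d = 0` is vacuous since then `𝔪 = ⊥`). Pick `g ∈ I ∖ 𝔪²`.
If `d = 1`, `R/(g)` is regular of dimension `0`, so `𝔪 ⊆ (g) ⊆ I` and `𝔮 = ⊥` works. If `d ≥ 2`,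
`R/(g)` is regular of dimension `d - 1 ≥ 1`, which gives `w ∈ 𝔪` with `w ∉ 𝔪² + (g)`. For
representatives `c₀, c₁, …` of distinct residue classes put `xᵢ := w + cᵢ g`: each `xᵢ` lies in
`𝔪 ∖ 𝔪²` (so it is a prime element, Matsumura 14.3), `g ∉ 𝔪² + (xᵢ)`, and `xⱼ ∤ xᵢ` for `i ≠ j`.
If every `xᵢ` divided `ϖ` then `x₀ ⋯ x_{N-1} ∣ ϖ`, i.e. `ϖ ∈ 𝔪^N` for all `N`, so `ϖ = 0` by Krull's
intersection theorem. Hence some `x = xᵢ ∤ ϖ`; `R/(x)` is regular of dimension `d - 1` (Matsumura 14.2),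
with the same residue classes, `ϖ ≠ 0` there and `I·R/(x) ⊄ 𝔪̄²` (as `g ∉ 𝔪² + (x)`); the induction
hypothesis gives `𝔮̄ ⊂ R/(x)`, and its preimage `𝔮 ⊂ R` works (`R/𝔮 ≅ (R/(x))/𝔮̄`).
-/

set_option linter.dupNamespace false -- mandated namespace `Summit.<Summit>.<Problem>` of this single-conjunct summit

namespace Summit.ResolutionOfSingularities.ResolutionOfSingularities.Cruxes.EquisingularLift.StrataSplit

open IsLocalRing Literature.AlgebraicGeometry.Resolution

universe u

variable {R : Type u} [CommRing R]

/-- If `w ∉ 𝔪² + (g)` then `w + c·g ∉ 𝔪²`. [OURS · L1 W4.5b] helper for `stub_exists_arc_transversal`. -/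
theorem add_mul_not_mem_sq [IsLocalRing R] {w g : R}
    (hw : w ∉ maximalIdeal R ^ 2 ⊔ Ideal.span {g}) (c : R) : w + c * g ∉ maximalIdeal R ^ 2 := by
  intro h
  apply hw
  have : w = (w + c * g) - c * g := by ring
  rw [this]
  exact Ideal.sub_mem _ (Ideal.mem_sup_left h)
    (Ideal.mem_sup_right (Ideal.mul_mem_left _ c (Ideal.mem_span_singleton_self g)))

/-- In a local ring: if `g ∉ 𝔪²`, `w ∈ 𝔪` and `w ∉ 𝔪² + (g)`, then `g ∉ 𝔪² + (w + c·g)` for every `c`.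
[OURS · L1 W4.5b] helper for `stub_exists_arc_transversal`. -/
theorem not_mem_sq_sup_span_add_mul [IsLocalRing R] {w g : R} (hg2 : g ∉ maximalIdeal R ^ 2)
    (hw1 : w ∈ maximalIdeal R) (hw : w ∉ maximalIdeal R ^ 2 ⊔ Ideal.span {g}) (c : R) :
    g ∉ maximalIdeal R ^ 2 ⊔ Ideal.span {w + c * g} := by
  intro h
  obtain ⟨m, hm, z, hz, hmz⟩ := Submodule.mem_sup.mp h
  obtain ⟨r, rfl⟩ := Ideal.mem_span_singleton'.mp hz
  by_cases hr : IsUnit r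
  · -- `r` a unit: then `w ∈ 𝔪² + (g)`
    obtain ⟨u, rfl⟩ := hr
    apply hw
    have hrw : (u : R) * w = (1 - (u : R) * c) * g - m := by linear_combination hmz
    have hmem : (u : R) * w ∈ maximalIdeal R ^ 2 ⊔ Ideal.span {g} := by
      rw [hrw]
      exact Ideal.sub_mem _
        (Ideal.mem_sup_right (Ideal.mul_mem_left _ _ (Ideal.mem_span_singleton_self g)))
        (Ideal.mem_sup_left hm)
    have : w = (↑u⁻¹ : R) * ((u : R) * w) := by rw [← mul_assoc, Units.inv_mul, one_mul]
    rw [this]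
    exact Ideal.mul_mem_left _ _ hmem
  · -- `r ∈ 𝔪`: then `g (1 - r c) ∈ 𝔪²` with `1 - r c` a unit, so `g ∈ 𝔪²`
    apply hg2
    have hr' : r ∈ maximalIdeal R := (mem_maximalIdeal r).mpr hr
    obtain ⟨v, hv⟩ := isUnit_one_sub_self_of_mem_nonunits (r * c)
      ((mem_maximalIdeal _).mp (Ideal.mul_mem_right c _ hr'))
    have hgv : g * (1 - r * c) = m + r * w := by linear_combination -hmz
    have hmem : g * (1 - r * c) ∈ maximalIdeal R ^ 2 := by
      rw [hgv, pow_two]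
      exact Ideal.add_mem _ (by rw [← pow_two]; exact hm) (Ideal.mul_mem_mul hr' hw1)
    have : g = g * (1 - r * c) * (↑v⁻¹ : R) := by rw [← hv, mul_assoc, Units.mul_inv, mul_one]
    rw [this]
    exact Ideal.mul_mem_right _ _ hmem

/-- In a local ring: if `g ∉ 𝔪²`, `w ∈ 𝔪`, `w ∉ 𝔪² + (g)` and `c - c'` is a unit, then
`w + c'·g ∤ w + c·g`. [OURS · L1 W4.5b] helper for `stub_exists_arc_transversal`. -/
theorem not_dvd_add_mul_of_isUnit_sub [IsLocalRing R] {w g c c' : R} (hg2 : g ∉ maximalIdeal R ^ 2)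
    (hw1 : w ∈ maximalIdeal R) (hw : w ∉ maximalIdeal R ^ 2 ⊔ Ideal.span {g})
    (hu : IsUnit (c - c')) : ¬ (w + c' * g ∣ w + c * g) := by
  rintro ⟨s, hs⟩
  apply not_mem_sq_sup_span_add_mul hg2 hw1 hw c'
  obtain ⟨u, hu⟩ := hu
  have key : (u : R) * g = (w + c' * g) * (s - 1) := by rw [hu]; linear_combination hs
  have hg : g = (w + c' * g) * ((↑u⁻¹ : R) * (s - 1)) := by
    calc g = (↑u⁻¹ : R) * ((u : R) * g) := by rw [← mul_assoc, Units.inv_mul, one_mul]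
      _ = (w + c' * g) * ((↑u⁻¹ : R) * (s - 1)) := by rw [key]; ring
  exact Ideal.mem_sup_right (Ideal.mem_span_singleton.mpr (Dvd.intro _ hg.symm))

/-- In a Noetherian local ring: if `x₀, x₁, …` are prime elements of `𝔪` with `xⱼ ∤ xᵢ` for `i ≠ j`,
all dividing `ϖ`, then `ϖ = 0` (`x₀ ⋯ x_{N-1} ∣ ϖ` puts `ϖ` in `𝔪^N` for every `N`; Krull's
intersection theorem). [OURS · L1 W4.5b] helper for `stub_exists_arc_transversal`. -/
theorem eq_zero_of_forall_prime_dvd [IsLocalRing R] [IsNoetherianRing R] {x : ℕ → R} {ϖ : R}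
    (hx : ∀ i, x i ∈ maximalIdeal R) (hprime : ∀ i, Prime (x i))
    (hnd : ∀ i j, i ≠ j → ¬ (x j ∣ x i)) (hdvd : ∀ i, x i ∣ ϖ) : ϖ = 0 := by
  have key : ∀ N : ℕ, (∏ i ∈ Finset.range N, x i) ∣ ϖ ∧
      (∏ i ∈ Finset.range N, x i) ∈ maximalIdeal R ^ N := by
    intro N
    induction N with
    | zero => simp
    | succ N ih =>
      obtain ⟨⟨y, hy⟩, hmem⟩ := ih
      rw [Finset.prod_range_succ]
      refine ⟨?_, ?_⟩
      · have hN : ¬ x N ∣ ∏ i ∈ Finset.range N, x i :=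
          (hprime N).not_dvd_finsetProd fun i hi => hnd i N (Finset.mem_range.mp hi).ne
        have hϖ := hdvd N
        rw [hy] at hϖ
        rcases (hprime N).dvd_or_dvd hϖ with h | h
        · exact absurd h hN
        · obtain ⟨z, rfl⟩ := h
          exact ⟨z, by rw [hy]; ring⟩
      · rw [pow_succ]
        exact Ideal.mul_mem_mul hmem (hx N)
  have hmem : ϖ ∈ ⨅ n : ℕ, maximalIdeal R ^ n := by
    refine Ideal.mem_iInf.mpr fun n => ?_
    obtain ⟨⟨y, hy⟩, hn⟩ := key n
    rw [hy]
    exact Ideal.mul_mem_right _ _ hn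
  rwa [Ideal.iInf_pow_eq_bot_of_isLocalRing _ (maximalIdeal.isMaximal R).ne_top, Ideal.mem_bot] at hmem

/-- A regular local ring of Krull dimension `0` is a field: `𝔪 = ⊥`. [OURS · L1 W4.5b] helper for
`stub_exists_arc_transversal`. -/
theorem maximalIdeal_eq_bot_of_ringKrullDim_eq_zero [IsRegularLocalRing R] (h : ringKrullDim R = 0) :
    maximalIdeal R = ⊥ := by
  have hreg := (isRegularLocalRing_iff R).mp ‹_›
  rw [h] at hreg
  have h0 : (maximalIdeal R).spanFinrank = 0 := by exact_mod_cast hreg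
  exact (Submodule.spanFinrank_eq_zero_iff_eq_bot (IsNoetherian.noetherian _)).mp h0

/-- A local ring with infinite residue field contains a sequence `c₀, c₁, …` of representatives of
distinct residue classes: `cᵢ - cⱼ` is a unit for `i ≠ j`. [OURS · L1 W4.5b] helper for
`stub_exists_arc_transversal`. -/
theorem exists_seq_isUnit_sub [IsLocalRing R] [Infinite (ResidueField R)] :
    ∃ c : ℕ → R, ∀ i j, i ≠ j → IsUnit (c i - c j) := by
  let e := Infinite.natEmbedding (ResidueField R)
  choose c hc using fun i => residue_surjective (R := R) (e i)
  refine ⟨c, fun i j hij => ?_⟩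
  by_contra hu
  have hmem : c i - c j ∈ maximalIdeal R := (mem_maximalIdeal _).mpr hu
  rw [← residue_eq_zero_iff, map_sub, hc, hc, sub_eq_zero] at hmem
  exact hij (e.injective hmem)

/-- **Induction core of `stub_exists_arc_transversal`** (on `n`, for regular local rings of dimension
`n + 1`, with "infinite residue field" replaced by the robust datum of a sequence of representatives of
distinct residue classes, which passes to quotients). [OURS · L1 W4.5b]
[cite: Matsumura1987, Thm. 14.2, Thm. 14.3] -/
theorem exists_arc_transversal_aux (n : ℕ) : ∀ (R : Type) [CommRing R] [IsRegularLocalRing R],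
    ringKrullDim R = (n + 1 : ℕ) → (∃ c : ℕ → R, ∀ i j, i ≠ j → IsUnit (c i - c j)) →
    ∀ (ϖ : R) (I : Ideal R), ϖ ≠ 0 → I ≤ maximalIdeal R → ¬ I ≤ maximalIdeal R ^ 2 →
    ∃ 𝔮 : Ideal R, IsRegularLocalRing (R ⧸ 𝔮) ∧ ringKrullDim (R ⧸ 𝔮) = 1 ∧ ϖ ∉ 𝔮 ∧
      𝔮 ⊔ I = maximalIdeal R := by
  induction n with
  | zero =>
    -- `dim R = 1`: `𝔮 = ⊥`
    intro R _ _ hdim _ ϖ I hϖ hI hI2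
    obtain ⟨g, hgI, hg2⟩ : ∃ g ∈ I, g ∉ maximalIdeal R ^ 2 := by
      simpa using SetLike.not_le_iff_exists.mp hI2
    have hg : g ∈ maximalIdeal R := hI hgI
    obtain ⟨hreg, hdim'⟩ := IsRegularLocalRing.quotient_span_singleton hg hg2
    have h0 : ringKrullDim (R ⧸ Ideal.span {g}) = 0 := by
      obtain ⟨m, hm⟩ := exists_nat_cast_eq_ringKrullDim (R := R ⧸ Ideal.span {g})
      rw [hm, hdim] at hdim'
      have : m + 1 = 0 + 1 := by exact_mod_cast hdim'
      have hm0 : m = 0 := by omega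
      rw [hm, hm0]; rfl
    have hbot := maximalIdeal_eq_bot_of_ringKrullDim_eq_zero h0
    have hmI : maximalIdeal R ≤ I := by
      intro m hm
      have hm' : Ideal.Quotient.mk (Ideal.span {g}) m ∈ maximalIdeal (R ⧸ Ideal.span {g}) :=
        (mk_mem_maximalIdeal_quotient_iff _ m).mpr (Ideal.mem_sup_left hm)
      rw [hbot, Ideal.mem_bot, Ideal.Quotient.eq_zero_iff_mem, Ideal.mem_span_singleton'] at hm'
      obtain ⟨a, rfl⟩ := hm'
      exact I.mul_mem_left a hgI
    refine ⟨⊥, IsRegularLocalRing.of_ringEquiv (RingEquiv.quotientBot R).symm, ?_, ?_, ?_⟩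
    · rw [ringKrullDim_eq_of_ringEquiv (RingEquiv.quotientBot R), hdim]; rfl
    · simpa using hϖ
    · rw [bot_sup_eq]; exact le_antisymm hI hmI
  | succ n ih =>
    -- `dim R = n + 2 ≥ 2`: cut by a suitable `x = w + c·g`
    intro R _ _ hdim hc ϖ I hϖ hI hI2
    obtain ⟨c, hc⟩ := hc
    obtain ⟨g, hgI, hg2⟩ : ∃ g ∈ I, g ∉ maximalIdeal R ^ 2 := by
      simpa using SetLike.not_le_iff_exists.mp hI2
    have hg : g ∈ maximalIdeal R := hI hgI
    -- a second cotangent direction `w`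
    obtain ⟨w, hw1, hw⟩ : ∃ w ∈ maximalIdeal R, w ∉ maximalIdeal R ^ 2 ⊔ Ideal.span {g} := by
      obtain ⟨hreg, hdim'⟩ := IsRegularLocalRing.quotient_span_singleton hg hg2
      have hne : ringKrullDim (R ⧸ Ideal.span {g}) ≠ 0 := by
        intro h0
        rw [h0, hdim, zero_add] at hdim'
        have : (1 : ℕ) = n + 1 + 1 := by exact_mod_cast hdim'
        omega
      obtain ⟨w', hw'1, hw'2⟩ := IsRegularLocalRing.exists_not_mem_sq hne
      obtain ⟨w, rfl⟩ := Ideal.Quotient.mk_surjective w'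
      refine ⟨w, ?_, fun h => hw'2 ((mk_mem_sq_maximalIdeal_quotient_iff _ w).mpr h)⟩
      have := (mk_mem_maximalIdeal_quotient_iff _ w).mp hw'1
      rwa [sup_eq_left.mpr ((Ideal.span_singleton_le_iff_mem _).mpr hg)] at this
    -- the pencil `xᵢ = w + cᵢ g`
    obtain ⟨x, hx⟩ : ∃ x : ℕ → R, ∀ i, x i = w + c i * g := ⟨fun i => w + c i * g, fun _ => rfl⟩
    have hx1 : ∀ i, x i ∈ maximalIdeal R := fun i =>
      (hx i).symm ▸ add_mem hw1 (Ideal.mul_mem_left _ _ hg)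
    have hx2 : ∀ i, x i ∉ maximalIdeal R ^ 2 := fun i => (hx i).symm ▸ add_mul_not_mem_sq hw (c i)
    have hgx : ∀ i, g ∉ maximalIdeal R ^ 2 ⊔ Ideal.span {x i} := fun i =>
      (hx i).symm ▸ not_mem_sq_sup_span_add_mul hg2 hw1 hw (c i)
    have hprime : ∀ i, Prime (x i) := fun i => IsRegularLocalRing.prime_of_not_mem_sq (hx1 i) (hx2 i)
    have hnd : ∀ i j, i ≠ j → ¬ (x j ∣ x i) := fun i j hij => by
      rw [hx i, hx j]
      exact not_dvd_add_mul_of_isUnit_sub hg2 hw1 hw (hc i j hij)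
    -- some member of the pencil does not divide `ϖ`
    obtain ⟨i, hi⟩ : ∃ i, ¬ (x i ∣ ϖ) := by
      by_contra! h
      exact hϖ (eq_zero_of_forall_prime_dvd hx1 hprime hnd h)
    -- pass to `R' = R ⧸ (xᵢ)`
    obtain ⟨hreg', hdim'⟩ := IsRegularLocalRing.quotient_span_singleton (hx1 i) (hx2 i)
    set mk := Ideal.Quotient.mk (Ideal.span {x i}) with hmk
    have hdimR' : ringKrullDim (R ⧸ Ideal.span {x i}) = (n + 1 : ℕ) := by
      obtain ⟨m, hm⟩ := exists_nat_cast_eq_ringKrullDim (R := R ⧸ Ideal.span {x i})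
      rw [hm, hdim] at hdim'
      have : m + 1 = n + 1 + 1 := by exact_mod_cast hdim'
      have hmn : m = n + 1 := by omega
      rw [hm, hmn]
    have hc' : ∃ c' : ℕ → R ⧸ Ideal.span {x i}, ∀ a b, a ≠ b → IsUnit (c' a - c' b) :=
      ⟨fun a => mk (c a), fun a b hab => by simpa [map_sub] using (hc a b hab).map mk⟩
    have hϖ' : mk ϖ ≠ 0 := by
      rw [Ne, Ideal.Quotient.eq_zero_iff_mem, Ideal.mem_span_singleton]
      exact hi
    have hI' : I.map mk ≤ maximalIdeal (R ⧸ Ideal.span {x i}) := by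
      rw [Ideal.map_le_iff_le_comap]
      intro a ha
      exact (mk_mem_maximalIdeal_quotient_iff _ a).mpr (Ideal.mem_sup_left (hI ha))
    have hI2' : ¬ I.map mk ≤ maximalIdeal (R ⧸ Ideal.span {x i}) ^ 2 := fun h =>
      hgx i ((mk_mem_sq_maximalIdeal_quotient_iff _ g).mp (h (Ideal.mem_map_of_mem mk hgI)))
    obtain ⟨𝔮', hreg𝔮, hdim𝔮, hϖ𝔮, hsup⟩ :=
      ih (R ⧸ Ideal.span {x i}) hdimR' hc' (mk ϖ) (I.map mk) hϖ' hI' hI2'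
    -- pull the arc back to `R`
    let f : R →+* (R ⧸ Ideal.span {x i}) ⧸ 𝔮' := (Ideal.Quotient.mk 𝔮').comp mk
    have hf : Function.Surjective f :=
      Ideal.Quotient.mk_surjective.comp Ideal.Quotient.mk_surjective
    refine ⟨RingHom.ker f,
      IsRegularLocalRing.of_ringEquiv (RingHom.quotientKerEquivOfSurjective hf).symm, ?_, ?_, ?_⟩
    · rw [ringKrullDim_eq_of_ringEquiv (RingHom.quotientKerEquivOfSurjective hf), hdim𝔮]
    · rwa [RingHom.mem_ker, RingHom.comp_apply, Ideal.Quotient.eq_zero_iff_mem]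
    · apply le_antisymm
      · exact sup_le (le_maximalIdeal (RingHom.ker_ne_top f)) hI
      · intro m hm
        have hm' : mk m ∈ maximalIdeal (R ⧸ Ideal.span {x i}) :=
          (mk_mem_maximalIdeal_quotient_iff _ m).mpr (Ideal.mem_sup_left hm)
        rw [← hsup] at hm'
        obtain ⟨a, ha, b, hb, hab⟩ := Submodule.mem_sup.mp hm'
        obtain ⟨i', hi'I, rfl⟩ := (Ideal.mem_map_iff_of_surjective mk Ideal.Quotient.mk_surjective).mp hb
        have hmi : m - i' ∈ RingHom.ker f := by
          rw [RingHom.mem_ker, RingHom.comp_apply, Ideal.Quotient.eq_zero_iff_mem, map_sub, ← hab,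
            add_sub_cancel_right]
          exact ha
        have : m = (m - i') + i' := by ring
        rw [this]
        exact Submodule.add_mem_sup hmi hi'I

/-- **STUB `stub_exists_arc_transversal`** (free arcs through any point; registered stub of the line
`Sketch` for the crux `EquisingularLift`, stmt-ResolutionOfSingularities-15660, by name and signature).
In a regular local ring `R` with infinite residue field, for every non-zero `ϖ` and every ideal
`I ⊆ 𝔪` not contained in `𝔪²` there is an ideal `𝔮` with `R/𝔮` regular local of dimension `1`
(a DVR: the arc), `ϖ ∉ 𝔮` (horizontal) and `𝔮 + I = 𝔪` (the arc's trace generates the maximal ideal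
of `R/I`). [OURS · L1 W4.5b] move-set lemma; NOT a statement of the manuscript.
[cite: Matsumura1987, Thm. 14.2, Thm. 14.3] -/
theorem stub_exists_arc_transversal : ∀ (R : Type) [CommRing R] [IsRegularLocalRing R], Infinite (IsLocalRing.ResidueField R) → ∀ (ϖ : R) (I : Ideal R), ϖ ≠ 0 → I ≤ IsLocalRing.maximalIdeal R → ¬ I ≤ IsLocalRing.maximalIdeal R ^ 2 → ∃ 𝔮 : Ideal R, IsRegularLocalRing (R ⧸ 𝔮) ∧ ringKrullDim (R ⧸ 𝔮) = 1 ∧ ϖ ∉ 𝔮 ∧ 𝔮 ⊔ I = IsLocalRing.maximalIdeal R := by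
  intro R _ _ hinf ϖ I hϖ hI hI2
  have hc : ∃ c : ℕ → R, ∀ i j, i ≠ j → IsUnit (c i - c j) := exists_seq_isUnit_sub
  obtain ⟨d, hd⟩ := exists_nat_cast_eq_ringKrullDim (R := R)
  cases d with
  | zero =>
    -- `dim R = 0`: `𝔪 = ⊥`, so `I ⊆ 𝔪²` — the hypotheses are contradictory
    exfalso
    apply hI2
    have hbot : maximalIdeal R = ⊥ := maximalIdeal_eq_bot_of_ringKrullDim_eq_zero (by rw [hd]; rfl)
    rw [hbot] at hI
    exact hI.trans bot_le
  | succ n => exact exists_arc_transversal_aux n R hd hc ϖ I hϖ hI hI2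

end Summit.ResolutionOfSingularities.ResolutionOfSingularities.Cruxes.EquisingularLift.StrataSplit
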